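import Summits.QuantumFields.YangMills.Theorems.AllWindowsColdBoxBoxHighLineTiltSupBoundsWilson
import Summits.QuantumFields.YangMills.Theorems.AllWindowsColdBoxBoxHighLinePlaquetteObsL2ByName
import Summits.QuantumFields.YangMills.Theorems.AllWindowsColdBoxBoxHighLineEdgeChartHyper
import Summits.QuantumFields.YangMills.Theorems.AllWindowsColdBoxBoxHighLineGaussCovMainReduction
import Summits.QuantumFields.YangMills.Theorems.AllWindowsColdBoxBoxHighLineTiltCumulantBounds
import Summits.QuantumFields.YangMills.Theorems.AllWindowsColdBoxBoxHighLineCubicByName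
import Summits.QuantumFields.YangMills.Theorems.AllWindowsColdBoxBoxHighLinePhiTaylor
import Summits.QuantumFields.YangMills.Theorems.AllWindowsColdBoxBoxHighLineTiltTruncation

/-!
# T-S5.13K-M — the remaining MOMENT SIZES on the small-field box for `κ₃(0)` (LEAD's ✓`Tilt.abs_tiltCum3_muD_zero_le`, four Hölder sizes):
# `E₀[1_D(E − a₁)⁴]`, `E₀[1_D(E − a₁)²]` for the EVEN part `E = c − c^{odd}` of the plaquette cost, `E₀[1_D(c^{odd})⁴]`, and `E₀[1_D·U_o²]` for the ODD part of `tiltU`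
# (LEAD sfw-p2 g77 21:05:29Z «(e4) is BY NAME down to eight moment sizes E_0[Ẽ⁴], E_0[O⁴], E_0[Ũ_e²], E_0[U_o²]»; ASSEMBLY-S5 §6 (e4); LINE-19 S5 ⟨stmt-QuantumFields-24004⟩)

Width seat `ym-line-sfw-p2-w4` (prover-ym-line-sfw-p2-w4-g28-0).  `c = chartPlaqCost H x 1 2` (any base point), `O = chartPlaqCostOdd H x 1 2`, `E = c − O`,
`a₁ = gaussAvg β H (linCurvSq H (plaq12At x))`, `D = smallField H s`, `0 ≤ s ≤ 1`:

* `TiltSup.gaussAvg_sfInd_even_sub_mean_sq_le` — `E₀[1_D(E − a₁)²] ≤ C(1+log H)²/β²` (`H ≥ 1`, `β ≥ 1`);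
* ★`TiltSup.gaussAvg_sfInd_even_sub_mean_pow_four_le` — `E₀[1_D(E − a₁)⁴] ≤ C(1+log H)⁴/β⁴` (`(E−a₁)⁴ ≤ 8(|ℓ|²−a₁)⁴ + 8R⁴`; Bonami–Nelson
  ✓`gaussAvg_sq_mul_sq_le_of_polyCert` on `(|ℓ|²−a₁)²·(|ℓ|²−a₁)²` with LEAD's ✓`gaussAvg_centred_linCurvSq_sq_le`; `1_D R⁴ ≤ (200s³)²R²` with ✓12d clause 3);
  recentring at the `μ_D`-mean `m`: `(E−m)⁴ ≤ 8(E−a₁)⁴ + 8(m−a₁)⁴` is left to the consumer (`(m−a₁)² ≤ E₀-average of (E−a₁)²`);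
* `TiltSup.gaussAvg_sfInd_odd_pow_four_le` — `E₀[1_D·O⁴] ≤ 10⁴·s⁶·C₁₂/β³` (`1_D O⁴ ≤ (100s³)²O²`, ✓12d clause 2);
* parity letters `haarLogRatio_neg`, `flat_neg`, `quadVal_neg`, ★`tiltU_sub_tiltU_neg` (`tiltU(a) − tiltU(−a) = −2·cubicVertex(a) + (ghostLogRatio(a) − ghostLogRatio(−a))`,
  from ✓`cubicVertex_neg`/`quarticWilson_neg`/`divLinSq_neg` (EdgeChartParity), ✓7b clause 1, `haarLogRatio_neg`);
* ★`TiltSup.gaussAvg_sfInd_tiltU_odd_sq_le_of (h7d : GhostTaylor)` — with `U_o(a) := (tiltU β H a − tiltU β H (−a))/2`: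
  `E₀[1_D·U_o²] ≤ 2·C₁₂ₐ(1+log H)^{m}H⁴/β + 2·(C_g(1+log H)^{m}H⁶s³)²` for `H ≥ 1`, `H⁴ ≤ β`, `s·H² ≤ c₀` (`|U_o + cubicVertex| ≤ C_gH⁶(1+log H)^m s³` on `D`
  since `quadVal` is even; ✓12a `cubicVariance`).

Everything proved; no definitions; standard axioms.  HONEST LABEL: support sizes for the OPEN assembly T-S5.13 of the XL stub S5 of a critic-PASSed DRAFT line;
S5, U5, ⟨24004⟩ ⟨24335⟩ ⟨24336⟩ remain OPEN; no crux, rung or summit is proved; the Yang–Mills mass gap is NOT proved by this file.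
-/

set_option autoImplicit false

open MeasureTheory Real Finset Matrix
open Literature.Probability.LatticeModels (Site)
open Summit.QuantumFields.YangMills.Theorems.WeakCouplingRates (plaq12At)

namespace Summit.QuantumFields.YangMills.Theorems.AllWindowsColdBoxBoxHighLine

namespace TiltSup

variable {H : ℕ}

/-! ## Small-field indicator bookkeeping -/

/-- `sfInd = 1` on the small-field box. -/
theorem sfInd_of_mem {s : ℝ} {a : LandauFree H → E3} (ha : a ∈ smallField H s) : sfInd H s a = 1 := by
  rw [sfInd, Set.indicator_of_mem ha]

/-- `sfInd = 0` off the small-field box. -/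
theorem sfInd_of_not_mem {s : ℝ} {a : LandauFree H → E3} (ha : a ∉ smallField H s) : sfInd H s a = 0 := by
  rw [sfInd, Set.indicator_of_notMem ha]

/-- `0 ≤ sfInd ≤ 1`. -/
theorem sfInd_nonneg_le_one (s : ℝ) (a : LandauFree H → E3) : 0 ≤ sfInd H s a ∧ sfInd H s a ≤ 1 := by
  by_cases ha : a ∈ smallField H s
  · rw [sfInd_of_mem ha]; norm_num
  · rw [sfInd_of_not_mem ha]; norm_num

/-! ## The even part of the plaquette cost: second and fourth restricted moments -/

/-- ★ **`E₀[1_D(E − a₁)⁴] ≤ C(1+log H)⁴/β⁴`** and **`E₀[1_D(E − a₁)²] ≤ C(1+log H)²/β²`** for the even part `E = c − c^{odd}` of the plaquette cost,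
`H ≥ 1`, `β ≥ 1`, `0 ≤ s ≤ 1`, any base point `x`. -/
theorem gaussAvg_sfInd_even_sub_mean_moments_le : ∃ C : ℝ, 0 ≤ C ∧ ∀ H : ℕ, 1 ≤ H → ∀ β : ℝ, 1 ≤ β → ∀ s : ℝ, 0 ≤ s → s ≤ 1 → ∀ x : Site 4,
    gaussAvg β H (fun a => sfInd H s a *
        (chartPlaqCost H x 1 2 a - chartPlaqCostOdd H x 1 2 a - gaussAvg β H (linCurvSq H (plaq12At x))) ^ 2) ≤ C * (1 + Real.log H) ^ 2 / β ^ 2 ∧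
    gaussAvg β H (fun a => sfInd H s a *
        (chartPlaqCost H x 1 2 a - chartPlaqCostOdd H x 1 2 a - gaussAvg β H (linCurvSq H (plaq12At x))) ^ 4) ≤ C * (1 + Real.log H) ^ 4 / β ^ 4 := by
  obtain ⟨Cv, hCv0, hV⟩ := EdgeChartGaussian.gaussAvg_centred_linCurvSq_sq_le
  obtain ⟨C₁₂, h12⟩ := plaquetteObsL2
  have hC₁₂ : 0 ≤ C₁₂ := by
    have h := (h12 1 le_rfl 1 le_rfl 0).2.1
    have h0 : 0 ≤ gaussAvg 1 1 (fun a => chartPlaqCostOdd 1 0 1 2 a ^ 2) := EdgeChartGaussian.gaussAvg_nonneg 1 one_pos fun a => sq_nonneg _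
    have : (0 : ℝ) ≤ C₁₂ / 1 ^ 3 := h0.trans h
    simpa using this
  refine ⟨2 * Cv + 2 * C₁₂ + 648 * Cv ^ 2 + 320000 * C₁₂, by positivity, fun H hH β hβ s hs0 hs1 x => ?_⟩
  have hβ0 : 0 < β := by linarith
  have hH1 : (1 : ℝ) ≤ H := by exact_mod_cast hH
  have hL1 : 1 ≤ 1 + Real.log (H : ℝ) := by have := Real.log_nonneg hH1; linarith
  -- inputs before abbreviating
  have hv := hV H hH β hβ0 (plaq12At x)
  have h3 := (h12 H hH β hβ x).2.2
  have hc4 : ∀ a : LandauFree H → E3, |chartPlaqCost H x 1 2 a| ≤ 4 := fun a =>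
    Summit.QuantumFields.YangMills.Theorems.WeakCouplingRates.abs_plaqCostAt_le x 1 2 (edgeChart H a)
  have hco4 : ∀ a : LandauFree H → E3, |chartPlaqCostOdd H x 1 2 a| ≤ 4 := fun a => EdgeChartGaussian.abs_chartPlaqCostOdd_le H x 1 2 a
  have hmeas_c := EdgeChartGaussian.measurable_chartPlaqCost H x 1 2
  have hmeas_co := EdgeChartGaussian.measurable_chartPlaqCostOdd H x 1 2
  have hmeas_L := EdgeChartGaussian.measurable_linCurvSq H (plaq12At x)
  have hcertL := EdgeChartGaussian.polyCert_linCurvSq H (plaq12At x)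
  have heven := fun (a : LandauFree H → E3) (ha : a ∈ smallField H s) => abs_chartPlaqCost_even_rem_le hs0 hs1 ha x (1 : Fin 4) (2 : Fin 4)
  set m₁ := gaussAvg β H (linCurvSq H (plaq12At x)) with hm₁
  set L := linCurvSq H (plaq12At x) with hL
  set c := chartPlaqCost H x 1 2 with hc
  set co := chartPlaqCostOdd H x 1 2 with hco
  have hcert : ∃ Q : MvPolynomial (LandauFree H × Fin 3) ℝ, Q.totalDegree ≤ 2 ∧
      ∀ a, (L a - m₁) = MvPolynomial.eval (LaplaceSandwich.flatten (LandauFree H) a) Q :=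
    EdgeChartGaussian.polyCert_sub hcertL (EdgeChartGaussian.polyCert_const m₁ 2)
  -- integrability
  have hIv : Integrable (fun a : LandauFree H → E3 => (L a - m₁) ^ 2 * gaussWeight β H a) :=
    EdgeChartGaussian.integrable_polyCert_mul_gaussWeight H hβ0 (EdgeChartGaussian.polyCert_pow hcert 2)
  have hIv4 : Integrable (fun a : LandauFree H → E3 => (L a - m₁) ^ 4 * gaussWeight β H a) :=
    EdgeChartGaussian.integrable_polyCert_mul_gaussWeight H hβ0 (EdgeChartGaussian.polyCert_pow hcert 4)
  have hIR : Integrable (fun a : LandauFree H → E3 => (c a - L a - co a) ^ 2 * gaussWeight β H a) := by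
    refine EdgeChartGaussian.integrable_mul_gaussWeight_of_abs_le H hβ0 (((hmeas_c.sub hmeas_L).sub hmeas_co).pow_const 2)
      (G := fun a => 96 + 3 * L a ^ 2) ?_ fun a => ?_
    · have hL2 : Integrable (fun a : LandauFree H → E3 => L a ^ 2 * gaussWeight β H a) :=
        EdgeChartGaussian.integrable_polyCert_mul_gaussWeight H hβ0 (EdgeChartGaussian.polyCert_pow hcertL 2)
      have := ((EdgeChartGaussian.integrable_gaussWeight H hβ0).const_mul 96).add (hL2.const_mul 3)
      exact this.congr (Filter.Eventually.of_forall fun a => by simp only [Pi.add_apply]; ring)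
    · rw [abs_pow, sq_abs]
      have h1 := hc4 a
      have h2' := hco4 a
      rw [abs_le] at h1 h2'
      have hc2 : c a ^ 2 ≤ 16 := by nlinarith [h1.1, h1.2]
      have hco2 : co a ^ 2 ≤ 16 := by nlinarith [h2'.1, h2'.2]
      nlinarith [sq_nonneg (c a + L a), sq_nonneg (co a - L a), sq_nonneg (c a + co a), hc2, hco2]
  -- pointwise dominations (`E − a₁ = (L − m₁) + R`, `R = c − L − co`, `|R| ≤ 200s³` on `D`)
  have h01 := sfInd_nonneg_le_one (H := H) s
  have hdom2 : ∀ a : LandauFree H → E3, sfInd H s a * (c a - co a - m₁) ^ 2 ≤ 2 * (L a - m₁) ^ 2 + 2 * (c a - L a - co a) ^ 2 := by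
    intro a
    have hsq : (c a - co a - m₁) ^ 2 ≤ 2 * (L a - m₁) ^ 2 + 2 * (c a - L a - co a) ^ 2 := by
      nlinarith [sq_nonneg ((L a - m₁) - (c a - L a - co a))]
    calc sfInd H s a * (c a - co a - m₁) ^ 2 ≤ 1 * (c a - co a - m₁) ^ 2 :=
          mul_le_mul_of_nonneg_right (h01 a).2 (sq_nonneg _)
      _ ≤ _ := by rw [one_mul]; exact hsq
  have hdom4 : ∀ a : LandauFree H → E3, sfInd H s a * (c a - co a - m₁) ^ 4 ≤
      8 * (L a - m₁) ^ 4 + 320000 * s ^ 6 * (c a - L a - co a) ^ 2 := by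
    intro a
    by_cases ha : a ∈ smallField H s
    · rw [sfInd_of_mem ha, one_mul]
      have hR := heven a ha
      have hR2 : (c a - L a - co a) ^ 2 ≤ (200 * s ^ 3) ^ 2 := by
        rw [← sq_abs]; exact pow_le_pow_left₀ (abs_nonneg _) hR 2
      have hq : (c a - co a - m₁) ^ 4 ≤ 8 * (L a - m₁) ^ 4 + 8 * (c a - L a - co a) ^ 4 := by
        have e : c a - co a - m₁ = (L a - m₁) + (c a - L a - co a) := by ring
        rw [e]
        nlinarith [sq_nonneg ((L a - m₁) ^ 2 - (c a - L a - co a) ^ 2), sq_nonneg ((L a - m₁) - (c a - L a - co a)),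
          sq_nonneg ((L a - m₁) + (c a - L a - co a)), mul_nonneg (sq_nonneg ((L a - m₁) - (c a - L a - co a))) (sq_nonneg ((L a - m₁) + (c a - L a - co a)))]
      have hR4 : (c a - L a - co a) ^ 4 ≤ (200 * s ^ 3) ^ 2 * (c a - L a - co a) ^ 2 := by
        have : (c a - L a - co a) ^ 4 = (c a - L a - co a) ^ 2 * (c a - L a - co a) ^ 2 := by ring
        rw [this]; exact mul_le_mul_of_nonneg_right hR2 (sq_nonneg _)
      nlinarith
    · rw [sfInd_of_not_mem ha, zero_mul]; positivity
  -- the integrable dominators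
  have hI2 : Integrable (fun a : LandauFree H → E3 => (2 * (L a - m₁) ^ 2 + 2 * (c a - L a - co a) ^ 2) * gaussWeight β H a) := by
    have := (hIv.const_mul 2).add (hIR.const_mul 2)
    exact this.congr (Filter.Eventually.of_forall fun a => by simp only [Pi.add_apply]; ring)
  have hI4 : Integrable (fun a : LandauFree H → E3 => (8 * (L a - m₁) ^ 4 + 320000 * s ^ 6 * (c a - L a - co a) ^ 2) * gaussWeight β H a) := by
    have := (hIv4.const_mul 8).add (hIR.const_mul (320000 * s ^ 6))
    exact this.congr (Filter.Eventually.of_forall fun a => by simp only [Pi.add_apply]; ring)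
  -- Gaussian sizes
  have hR := h3  -- `E₀[R²] ≤ C₁₂/β⁴`
  have hv4 : gaussAvg β H (fun a => (L a - m₁) ^ 4) ≤ 81 * (Cv * (1 + Real.log H) ^ 2 / β ^ 2) ^ 2 := by
    have hBN := EdgeChartGaussian.gaussAvg_sq_mul_sq_le_of_polyCert H hβ0 hcert hcert
    have e : (fun a : LandauFree H → E3 => (L a - m₁) ^ 4) = fun a => (L a - m₁) ^ 2 * (L a - m₁) ^ 2 := by funext a; ring
    rw [e]
    refine hBN.trans ?_
    have h0 : 0 ≤ gaussAvg β H (fun a => (L a - m₁) ^ 2) := EdgeChartGaussian.gaussAvg_nonneg H hβ0 fun a => sq_nonneg _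
    calc (3 : ℝ) ^ (2 + 2) * gaussAvg β H (fun a => (L a - m₁) ^ 2) * gaussAvg β H (fun a => (L a - m₁) ^ 2)
        = 81 * (gaussAvg β H (fun a => (L a - m₁) ^ 2)) ^ 2 := by norm_num; ring
      _ ≤ 81 * (Cv * (1 + Real.log H) ^ 2 / β ^ 2) ^ 2 := by gcongr
  have hβ2 : 0 < β ^ 2 := by positivity
  have hβ4 : 0 < β ^ 4 := by positivity
  constructor
  · -- second moment
    have hmono := EdgeChartGaussian.gaussAvg_mono_of_nonneg H hβ0 (fun a => mul_nonneg (h01 a).1 (sq_nonneg _)) hdom2 hI2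
    refine hmono.trans ?_
    have hI2a : Integrable (fun a : LandauFree H → E3 => 2 * (L a - m₁) ^ 2 * gaussWeight β H a) := by
      have := hIv.const_mul 2; exact this.congr (Filter.Eventually.of_forall fun a => by ring)
    have hI2b : Integrable (fun a : LandauFree H → E3 => 2 * (c a - L a - co a) ^ 2 * gaussWeight β H a) := by
      have := hIR.const_mul 2; exact this.congr (Filter.Eventually.of_forall fun a => by ring)
    rw [EdgeChartGaussian.gaussAvg_add β H hI2a hI2b, EdgeChartGaussian.gaussAvg_const_mul, EdgeChartGaussian.gaussAvg_const_mul]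
    have hb4 : C₁₂ / β ^ 4 ≤ C₁₂ * (1 + Real.log H) ^ 2 / β ^ 2 := by
      rw [div_le_div_iff₀ hβ4 hβ2]
      have : β ^ 2 ≤ β ^ 4 := pow_le_pow_right₀ hβ (by norm_num)
      have hL2 : 1 ≤ (1 + Real.log (H : ℝ)) ^ 2 := one_le_pow₀ hL1
      nlinarith [mul_le_mul_of_nonneg_left this hC₁₂, mul_nonneg hC₁₂ (le_of_lt hβ2),
        mul_le_mul_of_nonneg_left hL2 (mul_nonneg hC₁₂ (le_of_lt hβ2))]
    have e : (2 * Cv + 2 * C₁₂ + 648 * Cv ^ 2 + 320000 * C₁₂) * (1 + Real.log H) ^ 2 / β ^ 2 =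
        2 * (Cv * (1 + Real.log H) ^ 2 / β ^ 2) + 2 * (C₁₂ * (1 + Real.log H) ^ 2 / β ^ 2) +
          (648 * Cv ^ 2 + 320000 * C₁₂) * ((1 + Real.log H) ^ 2 / β ^ 2) := by ring
    rw [e]
    have hextra : 0 ≤ (648 * Cv ^ 2 + 320000 * C₁₂) * ((1 + Real.log H) ^ 2 / β ^ 2) := by positivity
    linarith
  · -- fourth moment
    have hmono := EdgeChartGaussian.gaussAvg_mono_of_nonneg H hβ0 (fun a => mul_nonneg (h01 a).1 (by positivity)) hdom4 hI4
    refine hmono.trans ?_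
    have hI4a : Integrable (fun a : LandauFree H → E3 => 8 * (L a - m₁) ^ 4 * gaussWeight β H a) := by
      have := hIv4.const_mul 8; exact this.congr (Filter.Eventually.of_forall fun a => by ring)
    have hI4b : Integrable (fun a : LandauFree H → E3 => 320000 * s ^ 6 * (c a - L a - co a) ^ 2 * gaussWeight β H a) := by
      have := hIR.const_mul (320000 * s ^ 6); exact this.congr (Filter.Eventually.of_forall fun a => by ring)
    rw [EdgeChartGaussian.gaussAvg_add β H hI4a hI4b, EdgeChartGaussian.gaussAvg_const_mul, EdgeChartGaussian.gaussAvg_const_mul]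
    have hs6 : s ^ 6 ≤ 1 := pow_le_one₀ hs0 hs1
    have hL4 : 1 ≤ (1 + Real.log (H : ℝ)) ^ 4 := one_le_pow₀ hL1
    have hT1 : 8 * gaussAvg β H (fun a => (L a - m₁) ^ 4) ≤ 648 * Cv ^ 2 * ((1 + Real.log H) ^ 4 / β ^ 4) := by
      refine (mul_le_mul_of_nonneg_left hv4 (by norm_num)).trans (le_of_eq ?_)
      field_simp
      ring
    have hT2 : 320000 * s ^ 6 * gaussAvg β H (fun a => (c a - L a - co a) ^ 2) ≤ 320000 * C₁₂ * ((1 + Real.log H) ^ 4 / β ^ 4) := by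
      have h0 : 0 ≤ gaussAvg β H (fun a => (c a - L a - co a) ^ 2) := EdgeChartGaussian.gaussAvg_nonneg H hβ0 fun a => sq_nonneg _
      calc 320000 * s ^ 6 * gaussAvg β H (fun a => (c a - L a - co a) ^ 2) ≤ 320000 * 1 * (C₁₂ / β ^ 4) := by gcongr
        _ = 320000 * C₁₂ * (1 / β ^ 4) := by ring
        _ ≤ 320000 * C₁₂ * ((1 + Real.log H) ^ 4 / β ^ 4) := by gcongr
    have e : (2 * Cv + 2 * C₁₂ + 648 * Cv ^ 2 + 320000 * C₁₂) * (1 + Real.log H) ^ 4 / β ^ 4 =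
        648 * Cv ^ 2 * ((1 + Real.log H) ^ 4 / β ^ 4) + 320000 * C₁₂ * ((1 + Real.log H) ^ 4 / β ^ 4) +
          (2 * Cv + 2 * C₁₂) * ((1 + Real.log H) ^ 4 / β ^ 4) := by ring
    rw [e]
    have hextra : 0 ≤ (2 * Cv + 2 * C₁₂) * ((1 + Real.log H) ^ 4 / β ^ 4) := by positivity
    linarith

/-! ## The odd part: fourth restricted moment -/

/-- **`E₀[1_D·(c^{odd})⁴] ≤ 10⁴·s⁶·C₁₂/β³`** for `H ≥ 1`, `β ≥ 1`, `0 ≤ s ≤ 1` (`1_D (c^{odd})⁴ ≤ (100s³)²(c^{odd})²` by ✓`abs_chartPlaqCostOdd_le`, ✓12d clause 2). -/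
theorem gaussAvg_sfInd_odd_pow_four_le : ∃ C : ℝ, 0 ≤ C ∧ ∀ H : ℕ, 1 ≤ H → ∀ β : ℝ, 1 ≤ β → ∀ s : ℝ, 0 ≤ s → s ≤ 1 → ∀ x : Site 4,
    gaussAvg β H (fun a => sfInd H s a * chartPlaqCostOdd H x 1 2 a ^ 4) ≤ C * s ^ 6 / β ^ 3 := by
  obtain ⟨C₁₂, h12⟩ := plaquetteObsL2
  have hC₁₂ : 0 ≤ C₁₂ := by
    have h := (h12 1 le_rfl 1 le_rfl 0).2.1
    have h0 : 0 ≤ gaussAvg 1 1 (fun a => chartPlaqCostOdd 1 0 1 2 a ^ 2) := EdgeChartGaussian.gaussAvg_nonneg 1 one_pos fun a => sq_nonneg _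
    have : (0 : ℝ) ≤ C₁₂ / 1 ^ 3 := h0.trans h
    simpa using this
  refine ⟨10000 * C₁₂, by positivity, fun H hH β hβ s hs0 hs1 x => ?_⟩
  have hβ0 : 0 < β := by linarith
  have h2 := (h12 H hH β hβ x).2.1
  have h01 := sfInd_nonneg_le_one (H := H) s
  have hodd := fun (a : LandauFree H → E3) (ha : a ∈ smallField H s) => abs_chartPlaqCostOdd_le hs0 hs1 ha x (1 : Fin 4) (2 : Fin 4)
  have hdom : ∀ a : LandauFree H → E3, sfInd H s a * chartPlaqCostOdd H x 1 2 a ^ 4 ≤ 10000 * s ^ 6 * chartPlaqCostOdd H x 1 2 a ^ 2 := by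
    intro a
    by_cases ha : a ∈ smallField H s
    · rw [sfInd_of_mem ha, one_mul]
      have ho2 : chartPlaqCostOdd H x 1 2 a ^ 2 ≤ (100 * s ^ 3) ^ 2 := by
        rw [← sq_abs]; exact pow_le_pow_left₀ (abs_nonneg _) (hodd a ha) 2
      have : chartPlaqCostOdd H x 1 2 a ^ 4 = chartPlaqCostOdd H x 1 2 a ^ 2 * chartPlaqCostOdd H x 1 2 a ^ 2 := by ring
      rw [this]
      nlinarith [sq_nonneg (chartPlaqCostOdd H x 1 2 a)]
    · rw [sfInd_of_not_mem ha, zero_mul]; positivity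
  have hIo : Integrable (fun a : LandauFree H → E3 => chartPlaqCostOdd H x 1 2 a ^ 2 * gaussWeight β H a) :=
    Tilt.integrable_bdd_mul_gaussWeight H hβ0 (C := 4 ^ 2) ((EdgeChartGaussian.measurable_chartPlaqCostOdd H x 1 2).pow_const 2)
      fun a => by rw [abs_pow]; exact pow_le_pow_left₀ (abs_nonneg _) (EdgeChartGaussian.abs_chartPlaqCostOdd_le H x 1 2 a) 2
  have hI : Integrable (fun a : LandauFree H → E3 => 10000 * s ^ 6 * chartPlaqCostOdd H x 1 2 a ^ 2 * gaussWeight β H a) := by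
    have := hIo.const_mul (10000 * s ^ 6); exact this.congr (Filter.Eventually.of_forall fun a => by ring)
  have hmono := EdgeChartGaussian.gaussAvg_mono_of_nonneg H hβ0 (fun a => mul_nonneg (h01 a).1 (by positivity)) hdom hI
  refine hmono.trans ?_
  rw [EdgeChartGaussian.gaussAvg_const_mul]
  calc 10000 * s ^ 6 * gaussAvg β H (fun a => chartPlaqCostOdd H x 1 2 a ^ 2) ≤ 10000 * s ^ 6 * (C₁₂ / β ^ 3) :=
        mul_le_mul_of_nonneg_left h2 (by positivity)
    _ = 10000 * C₁₂ * s ^ 6 / β ^ 3 := by ring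

/-! ## Parity letters and the odd part of the tilt exponent -/

/-- The Haar log-ratio is even. -/
theorem haarLogRatio_neg (a : LandauFree H → E3) : haarLogRatio H (-a) = haarLogRatio H a := by
  unfold haarLogRatio; simp only [Pi.neg_apply, norm_neg]

/-- `flat (−a) = −flat a`. -/
theorem flat_neg (a : LandauFree H → E3) : flat (-a) = -flat a := by
  funext i; simp [flat]

/-- A quadratic form is even. -/
theorem quadVal_neg (M : Matrix (LandauFree H × Fin 3) (LandauFree H × Fin 3) ℝ) (a : LandauFree H → E3) : quadVal M (-a) = quadVal M a := by
  unfold quadVal; rw [flat_neg, Matrix.mulVec_neg, dotProduct_neg, neg_dotProduct, neg_neg]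

/-- ★ **The odd part of the tilt exponent**: `tiltU(a) − tiltU(−a) = −2·cubicVertex(a) + (ghostLogRatio(a) − ghostLogRatio(−a))`
(the quartic Wilson part, the gauge-fixing part and the Haar part are even: ✓`quarticWilson_neg`, ✓7b clause 1, ✓`divLinSq_neg`, `haarLogRatio_neg`). -/
theorem tiltU_sub_tiltU_neg (hH : 1 ≤ H) (β : ℝ) (a : LandauFree H → E3) :
    tiltU β H a - tiltU β H (-a) = -2 * cubicVertex β H a + (ghostLogRatio H a - ghostLogRatio H (-a)) := by
  obtain ⟨C, hC⟩ := phiTaylor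
  have hphi := (hC H hH a).1
  rw [tiltU, tiltU, EdgeChartGaussian.cubicVertex_neg, EdgeChartGaussian.quarticWilson_neg, EdgeChartGaussian.divLinSq_neg,
    haarLogRatio_neg, hphi]
  ring

/-- ★ **`E₀[1_D·U_o²]` for the odd part `U_o(a) = (tiltU(a) − tiltU(−a))/2` of the tilt exponent, GIVEN T-S5.7d** (hypothesis verbatim):
for `H ≥ 1`, `H⁴ ≤ β`, `0 ≤ s`, `s·H² ≤ c₀`: `E₀[1_D·U_o²] ≤ 2·E₀[V₃²] + 2·(C·H⁶(1+log H)^m·s³)² ≤ 2C₁₂ₐ(1+log H)^{m'}H⁴/β + 2(C H⁶(1+log H)^m s³)²`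
(on `D`: `|U_o + cubicVertex| ≤ C H⁶ (1+log H)^m s³` since `quadVal M_H` is even; ✓12a `cubicVariance`). -/
theorem gaussAvg_sfInd_tiltU_odd_sq_le_of (h7d : GhostTaylor) :
    ∃ C c₀ : ℝ, ∃ m : ℕ, 0 ≤ C ∧ 0 < c₀ ∧ ∀ H : ℕ, 1 ≤ H → ∀ β : ℝ, (H : ℝ) ^ 4 ≤ β → ∀ s : ℝ, 0 ≤ s → s * (H : ℝ) ^ 2 ≤ c₀ →
      gaussAvg β H (fun a => sfInd H s a * ((tiltU β H a - tiltU β H (-a)) / 2) ^ 2) ≤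
        C * (1 + Real.log H) ^ m * ((H : ℝ) ^ 4 / β + (H : ℝ) ^ 12 * s ^ 6) := by
  obtain ⟨Cg, c₀, mg, hc₀, hG⟩ := h7d
  obtain ⟨C₁₂, m₁₂, h12a⟩ := cubicVariance
  refine ⟨2 * max C₁₂ 0 + 2 * (max Cg 0) ^ 2, c₀, max m₁₂ (2 * mg), by positivity, hc₀, fun H hH β hβ s hs0 hsH => ?_⟩
  have hH1 : (1 : ℝ) ≤ H := by exact_mod_cast hH
  have hβ1 : 1 ≤ β := le_trans (by nlinarith [one_le_pow₀ (M₀ := ℝ) hH1 (n := 4)]) hβ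
  have hβ0 : 0 < β := by linarith
  have hL1 : 1 ≤ 1 + Real.log (H : ℝ) := by have := Real.log_nonneg hH1; linarith
  obtain ⟨M, -, hT⟩ := hG H hH
  have hvar := h12a H hH β hβ
  have hmeas_V := GaussNormalForm.measurable_cubicVertex β H
  have hmeas_U := GaussNormalForm.measurable_tiltU β H
  have h01 := sfInd_nonneg_le_one (H := H) s
  set K : ℝ := max Cg 0 * (H : ℝ) ^ 6 * (1 + Real.log H) ^ mg * s ^ 3 with hK
  have hK0 : 0 ≤ K := by positivity
  -- on `D`: `|U_o + V₃| ≤ K`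
  have hUo : ∀ a ∈ smallField H s, |(tiltU β H a - tiltU β H (-a)) / 2 + cubicVertex β H a| ≤ K := by
    intro a ha
    have ha' : -a ∈ smallField H s := (EdgeChartGaussian.neg_mem_smallField_iff s a).2 ha
    have h1 : |ghostLogRatio H a - quadVal M a| ≤ Cg * (H : ℝ) ^ 6 * (1 + Real.log H) ^ mg * s ^ 3 := hT s a hs0 hsH ha
    have h2 : |ghostLogRatio H (-a) - quadVal M (-a)| ≤ Cg * (H : ℝ) ^ 6 * (1 + Real.log H) ^ mg * s ^ 3 := hT s (-a) hs0 hsH ha'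
    rw [quadVal_neg] at h2
    have e : (tiltU β H a - tiltU β H (-a)) / 2 + cubicVertex β H a =
        ((ghostLogRatio H a - quadVal M a) - (ghostLogRatio H (-a) - quadVal M a)) / 2 := by
      rw [tiltU_sub_tiltU_neg hH]; ring
    rw [e, abs_div, abs_two]
    have hCg : Cg * (H : ℝ) ^ 6 * (1 + Real.log H) ^ mg * s ^ 3 ≤ K := by
      rw [hK]; have h0 : 0 ≤ (H : ℝ) ^ 6 * (1 + Real.log H) ^ mg * s ^ 3 := by positivity
      calc Cg * (H : ℝ) ^ 6 * (1 + Real.log H) ^ mg * s ^ 3 = Cg * ((H : ℝ) ^ 6 * (1 + Real.log H) ^ mg * s ^ 3) := by ring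
        _ ≤ max Cg 0 * ((H : ℝ) ^ 6 * (1 + Real.log H) ^ mg * s ^ 3) := mul_le_mul_of_nonneg_right (le_max_left _ _) h0
        _ = _ := by ring
    have := abs_sub (ghostLogRatio H a - quadVal M a) (ghostLogRatio H (-a) - quadVal M a)
    rw [div_le_iff₀ (by norm_num : (0:ℝ) < 2)]
    linarith
  -- global bound on `V₃`
  have hVb : ∀ a : LandauFree H → E3, |cubicVertex β H a| ≤
      4 * |β| * (Literature.MathematicalPhysics.QuantumLattice.plaquettesTouching
        (Literature.MathematicalPhysics.QuantumFieldTheory.AxialGauge.boxEdges 4 (2 * H + 1))).card := by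
    intro a
    rw [cubicVertex, abs_mul]
    have h := Finset.abs_sum_le_sum_abs (fun p : Literature.MathematicalPhysics.QuantumLattice.ZdPlaquette 4 =>
      chartPlaqCostOdd H p.1 p.2.1.1 p.2.1.2 a)
      (Literature.MathematicalPhysics.QuantumLattice.plaquettesTouching
        (Literature.MathematicalPhysics.QuantumFieldTheory.AxialGauge.boxEdges 4 (2 * H + 1)))
    have h' := h.trans (Finset.sum_le_sum fun p _ => EdgeChartGaussian.abs_chartPlaqCostOdd_le H p.1 p.2.1.1 p.2.1.2 a)
    rw [Finset.sum_const, nsmul_eq_mul] at h'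
    calc |β| * |∑ p ∈ Literature.MathematicalPhysics.QuantumLattice.plaquettesTouching
          (Literature.MathematicalPhysics.QuantumFieldTheory.AxialGauge.boxEdges 4 (2 * H + 1)), chartPlaqCostOdd H p.1 p.2.1.1 p.2.1.2 a|
        ≤ |β| * (_ * 4) := mul_le_mul_of_nonneg_left h' (abs_nonneg _)
      _ = _ := by ring
  set BV : ℝ := 4 * |β| * (Literature.MathematicalPhysics.QuantumLattice.plaquettesTouching
        (Literature.MathematicalPhysics.QuantumFieldTheory.AxialGauge.boxEdges 4 (2 * H + 1))).card with hBV
  -- pointwise domination: `1_D U_o² ≤ 2 V₃² + 2 K² · 1_D ≤ 2V₃² + 2K²`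
  have hdom : ∀ a : LandauFree H → E3, sfInd H s a * ((tiltU β H a - tiltU β H (-a)) / 2) ^ 2 ≤ 2 * cubicVertex β H a ^ 2 + 2 * K ^ 2 := by
    intro a
    by_cases ha : a ∈ smallField H s
    · rw [sfInd_of_mem ha, one_mul]
      have h := hUo a ha
      rw [abs_le] at h
      nlinarith [sq_nonneg ((tiltU β H a - tiltU β H (-a)) / 2 + cubicVertex β H a - cubicVertex β H a), h.1, h.2,
        sq_nonneg ((tiltU β H a - tiltU β H (-a)) / 2 + 2 * cubicVertex β H a)]
    · rw [sfInd_of_not_mem ha, zero_mul]; positivity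
  have hIV : Integrable (fun a : LandauFree H → E3 => cubicVertex β H a ^ 2 * gaussWeight β H a) :=
    Tilt.integrable_bdd_mul_gaussWeight H hβ0 (C := BV ^ 2) (hmeas_V.pow_const 2)
      fun a => by rw [abs_pow]; exact pow_le_pow_left₀ (abs_nonneg _) (hVb a) 2
  have hIa : Integrable (fun a : LandauFree H → E3 => 2 * cubicVertex β H a ^ 2 * gaussWeight β H a) := by
    have := hIV.const_mul 2; exact this.congr (Filter.Eventually.of_forall fun a => by ring)
  have hIb : Integrable (fun a : LandauFree H → E3 => 2 * K ^ 2 * gaussWeight β H a) := (EdgeChartGaussian.integrable_gaussWeight H hβ0).const_mul _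
  have hI : Integrable (fun a : LandauFree H → E3 => (2 * cubicVertex β H a ^ 2 + 2 * K ^ 2) * gaussWeight β H a) := by
    have := hIa.add hIb; exact this.congr (Filter.Eventually.of_forall fun a => by simp only [Pi.add_apply]; ring)
  have hmono := EdgeChartGaussian.gaussAvg_mono_of_nonneg H hβ0 (fun a => mul_nonneg (h01 a).1 (sq_nonneg _)) hdom hI
  refine hmono.trans ?_
  have hsplit : gaussAvg β H (fun a => 2 * cubicVertex β H a ^ 2 + 2 * K ^ 2) = 2 * gaussAvg β H (fun a => cubicVertex β H a ^ 2) + 2 * K ^ 2 := by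
    rw [EdgeChartGaussian.gaussAvg_add β H hIa hIb, EdgeChartGaussian.gaussAvg_const_mul, EdgeChartGaussian.gaussAvg_const_fun H hβ0]
  rw [hsplit]
  -- sizes
  have hLm12 : (1 + Real.log (H : ℝ)) ^ m₁₂ ≤ (1 + Real.log (H : ℝ)) ^ max m₁₂ (2 * mg) := pow_le_pow_right₀ hL1 (le_max_left _ _)
  have hLmg : ((1 + Real.log (H : ℝ)) ^ mg) ^ 2 ≤ (1 + Real.log (H : ℝ)) ^ max m₁₂ (2 * mg) := by
    rw [← pow_mul, mul_comm]; exact pow_le_pow_right₀ hL1 (le_max_right _ _)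
  have hX1 : 0 ≤ (H : ℝ) ^ 4 / β := by positivity
  have hvar' : gaussAvg β H (fun a => cubicVertex β H a ^ 2) ≤ max C₁₂ 0 * (1 + Real.log H) ^ max m₁₂ (2 * mg) * ((H : ℝ) ^ 4 / β) := by
    refine hvar.trans ?_
    calc C₁₂ * (H : ℝ) ^ 4 * (1 + Real.log H) ^ m₁₂ / β = C₁₂ * ((1 + Real.log H) ^ m₁₂ * ((H : ℝ) ^ 4 / β)) := by ring
      _ ≤ max C₁₂ 0 * ((1 + Real.log H) ^ m₁₂ * ((H : ℝ) ^ 4 / β)) :=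
          mul_le_mul_of_nonneg_right (le_max_left _ _) (by positivity)
      _ ≤ max C₁₂ 0 * ((1 + Real.log H) ^ max m₁₂ (2 * mg) * ((H : ℝ) ^ 4 / β)) :=
          mul_le_mul_of_nonneg_left (mul_le_mul_of_nonneg_right hLm12 hX1) (le_max_right _ _)
      _ = _ := by ring
  have hK2 : K ^ 2 ≤ (max Cg 0) ^ 2 * (1 + Real.log H) ^ max m₁₂ (2 * mg) * ((H : ℝ) ^ 12 * s ^ 6) := by
    rw [hK]
    have e : (max Cg 0 * (H : ℝ) ^ 6 * (1 + Real.log H) ^ mg * s ^ 3) ^ 2 =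
        (max Cg 0) ^ 2 * ((1 + Real.log H) ^ mg) ^ 2 * ((H : ℝ) ^ 12 * s ^ 6) := by ring
    rw [e]
    have h0 : 0 ≤ (max Cg 0) ^ 2 := sq_nonneg _
    have h1 : 0 ≤ (H : ℝ) ^ 12 * s ^ 6 := by positivity
    exact mul_le_mul_of_nonneg_right (mul_le_mul_of_nonneg_left hLmg h0) h1
  have e : (2 * max C₁₂ 0 + 2 * (max Cg 0) ^ 2) * (1 + Real.log H) ^ max m₁₂ (2 * mg) * ((H : ℝ) ^ 4 / β + (H : ℝ) ^ 12 * s ^ 6) =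
      2 * (max C₁₂ 0 * (1 + Real.log H) ^ max m₁₂ (2 * mg) * ((H : ℝ) ^ 4 / β)) +
        2 * ((max Cg 0) ^ 2 * (1 + Real.log H) ^ max m₁₂ (2 * mg) * ((H : ℝ) ^ 12 * s ^ 6)) +
      (2 * max C₁₂ 0 * (1 + Real.log H) ^ max m₁₂ (2 * mg) * ((H : ℝ) ^ 12 * s ^ 6) +
        2 * (max Cg 0) ^ 2 * (1 + Real.log H) ^ max m₁₂ (2 * mg) * ((H : ℝ) ^ 4 / β)) := by ring
  have hextra : 0 ≤ 2 * max C₁₂ 0 * (1 + Real.log H) ^ max m₁₂ (2 * mg) * ((H : ℝ) ^ 12 * s ^ 6) +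
      2 * (max Cg 0) ^ 2 * (1 + Real.log H) ^ max m₁₂ (2 * mg) * ((H : ℝ) ^ 4 / β) := by positivity
  rw [e]
  linarith

end TiltSup

end Summit.QuantumFields.YangMills.Theorems.AllWindowsColdBoxBoxHighLine
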